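import Literature.Topology.FourManifolds.KhComplexQDegreeProofs
import Literature.Topology.FourManifolds.KhGaussElim
import HarnessLib

/-!
# Lee's differential and Gaussian elimination respect the quantum filtration

Sibling file of `LeeRasmussen.lean` (programme towards the named fact
`GaussDiagram.rasmussenInvariant_eq_of_equiv`), the filtered counterpart of the degree
bookkeeping `KhElim.Graded` / `MHtpy.IsGraded` of the Khovanov-homology programme
(`KhGaussElim`, `KhBigonHomotopy`):

* `qDegree_le_of_leeIncidence_ne_zero` — **Lee's differential does not decrease the quantum
  degree**: at `(h, t) = (0, 1)` a nonzero incidence number `⟨d s, s'⟩` forces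
  `qDegree s ≤ qDegree s'` (the terms `X ⊗ X ↦ 1` of `m` and `X ↦ 1 ⊗ 1` of `Δ` raise it by `4`,
  all the others keep it; Lee (2005), §3; Rasmussen (2010), §2.1: `d = d₀ + Φ`, `Φ` of degree `4`);
* `KhElim.Filt` — a linear map of coordinate vectors is *filtered* for integer-valued degree
  maps on the bases (`dT t ≤ dS s` on its support); composition, sums, matrix maps, the maps of
  `MHtpy.ofEquiv` and `MHtpy.rescale`, and **Gaussian elimination** (`filt_elim_F`,
  `filt_elim_B`: Bar-Natan (2007), Lemma 4.2, when the matrix is filtered and the cancelled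
  identity block joins states of equal degree);
* `MHtpy.IsFilt` — the two chain maps of total homotopy data are filtered; `refl`, `trans`,
  `ofEquiv`, `rescale`, `congrRight`, `elim` (for homotopy data between the incidence matrices of
  two Lee complexes, `IsFilt` for the quantum degrees is literally `GaussDiagram.QFiltered` of
  `LeeRasmussenHtpyProofs` for both maps).

Everything is proved; no named fact is introduced.

## References

* E. S. Lee, *An endomorphism of the Khovanov invariant*, Adv. Math. 197 (2005) 554–586, §3
  (the filtered differential `d + Φ`). [cite: Lee2005, §3]
* J. Rasmussen, *Khovanov homology and the slice genus*, Invent. Math. 182 (2010) 419–447,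
  §2.1 (Lee's differential is filtered), §6. [cite: Rasmussen2010, §2.1]
* D. Bar-Natan, *Fast Khovanov homology computations*, J. Knot Theory Ramifications 16 (2007)
  243–255, Lemma 4.2. [cite: BarNatan2007, Lemma 4.2]
-/

open Function Finset

noncomputable section

namespace Literature.Topology.FourManifolds

/-! ## Lee's differential is filtered -/

namespace GaussDiagram

variable {G : GaussDiagram}

/-- Lee's multiplication (`h = 0`, `t = 1`: `1·1 = 1`, `1·X = X·1 = X`, `X·X = 1`) does not
decrease `deg a + deg b - 1` (`deg 1 = 1`, `deg X = -1`). [folklore] -/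
private theorem deg_le_of_leeMergeCoeff_ne_zero {a b c : Bool} (h : mergeCoeff ℚ 0 1 a b c ≠ 0) :
    (if a then -1 else 1 : ℤ) + (if b then -1 else 1) - 1 ≤ (if c then -1 else 1) := by
  cases a <;> cases b <;> cases c <;> simp [mergeCoeff] at h ⊢

/-- Lee's comultiplication (`Δ 1 = 1 ⊗ X + X ⊗ 1`, `Δ X = X ⊗ X + 1 ⊗ 1`) does not decrease
`deg a - 1`. [folklore] -/
private theorem deg_le_of_leeSplitCoeff_ne_zero {a b c : Bool} (h : splitCoeff ℚ 0 1 a b c ≠ 0) :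
    (if a then -1 else 1 : ℤ) - 1 ≤ (if b then -1 else 1) + (if c then -1 else 1) := by
  cases a <;> cases b <;> cases c <;> simp [splitCoeff] at h ⊢

/-- **Lee's differential does not decrease the quantum degree**: a nonzero incidence number
`⟨d s, s'⟩` of the complex over `(ℚ, h = 0, t = 1)` forces `qDegree s ≤ qDegree s'`. Lee (2005),
§3; Rasmussen (2010), §2.1 (`d = d₀ + Φ` with `Φ` of `q`-degree `4`). Proof: as for
`qDegree_eq_of_incidence_ne_zero_holds`, with the surgery lemma `qDegree_sub_weight_surgery`
and the label constraints of Lee's tables. [cite: Rasmussen2010, §2.1] -/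
theorem qDegree_le_of_leeIncidence_ne_zero {s s' : G.EnhancedState} (h0 : G.incidence ℚ 0 1 s s' ≠ 0) :
    qDegree s ≤ qDegree s' := by
  unfold incidence at h0
  by_cases hi : ∃ i, s.state i = false ∧ s'.state = Function.update s.state i true
  swap
  · exact (h0 (by rw [dif_neg hi])).elim
  rw [dif_pos hi] at h0
  obtain ⟨hi0, hs'⟩ := Classical.choose_spec hi
  dsimp only at h0
  generalize Classical.choose hi = i at h0 hi0 hs'
  have hag : ∀ j, j ≠ i → s'.state j = s.state j := fun j hj ↦ by
    rw [hs', Function.update_of_ne hj]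
  have hag' : ∀ j, j ≠ i → s.state j = s'.state j := fun j hj ↦ (hag j hj).symm
  have hw : s'.state.weight = s.state.weight + 1 := by rw [hs', State.weight_update hi0]
  by_cases hM : G.IsMergeAt s.state i
  · rw [if_pos hM] at h0
    by_cases hl : ∀ c, G.circleOf s'.state c ≠ G.circleOf s'.state (G.arcIn (G.overPos i)) →
        s'.label c = s.label c
    swap
    · exact (h0 (by rw [if_neg hl])).elim
    rw [if_pos hl] at h0
    have hc := deg_le_of_leeMergeCoeff_ne_zero (right_ne_zero_of_mul h0)
    have heq : G.circleOf s'.state (G.arcIn (G.overPos i)) =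
        G.circleOf s'.state (G.arcOut (G.overPos i)) := by
      by_contra h
      refine IsMergeAt.not_isSplitAt_holds hM ⟨hi0, ?_⟩
      rwa [hs'] at h
    have key := qDegree_sub_weight_surgery hag hM.2 heq hl
    rw [hw] at key
    push_cast at key hc ⊢
    omega
  · rw [if_neg hM] at h0
    by_cases hS : G.IsSplitAt s.state i
    swap
    · exact (h0 (by rw [if_neg hS])).elim
    rw [if_pos hS] at h0
    by_cases hl : ∀ c, G.circleOf s.state c ≠ G.circleOf s.state (G.arcIn (G.overPos i)) →
        s'.label c = s.label c
    swap
    · exact (h0 (by rw [if_neg hl])).elim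
    rw [if_pos hl] at h0
    have hc := deg_le_of_leeSplitCoeff_ne_zero (right_ne_zero_of_mul h0)
    have hne : G.circleOf s'.state (G.arcIn (G.overPos i)) ≠
        G.circleOf s'.state (G.arcOut (G.overPos i)) := by
      have h := hS.2
      rwa [← hs'] at h
    have heq : G.circleOf s.state (G.arcIn (G.overPos i)) =
        G.circleOf s.state (G.arcOut (G.overPos i)) := by
      by_contra h
      exact hM ⟨hi0, h⟩
    have key := qDegree_sub_weight_surgery hag' hne heq (fun x hx ↦ (hl x hx).symm)
    rw [hw] at key
    push_cast at key hc ⊢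
    omega

end GaussDiagram

/-! ## Filtered maps of coordinate vectors -/

namespace KhElim

variable {R : Type} [CommRing R]

section Filt

variable {S T U : Type}

/-- A linear map between function spaces is **filtered** for the degree maps `dT`, `dS`: the
image of the basis vector `t` is supported on basis vectors `s` with `dT t ≤ dS s`.
Rasmussen (2010), §2.2. [cite: Rasmussen2010, §2.2] -/
def Filt [DecidableEq T] (dT : T → ℤ) (dS : S → ℤ) (F : (T → R) →ₗ[R] (S → R)) : Prop :=
  ∀ t s, F (Pi.single t 1) s ≠ 0 → dT t ≤ dS s

variable {dT : T → ℤ} {dS : S → ℤ} {dU : U → ℤ}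

/-- Filtered maps compose. [folklore] -/
theorem Filt.comp [DecidableEq T] [Fintype S] [DecidableEq S]
    {F : (T → R) →ₗ[R] (S → R)} {F' : (S → R) →ₗ[R] (U → R)}
    (hF : Filt dT dS F) (hF' : Filt dS dU F') : Filt dT dU (F' ∘ₗ F) := by
  intro t u hne
  rw [LinearMap.comp_apply, eq_sum_single (F (Pi.single t 1)), map_sum, Finset.sum_apply] at hne
  obtain ⟨s, -, hs⟩ := Finset.exists_ne_zero_of_sum_ne_zero hne
  rw [map_smul, Pi.smul_apply, smul_eq_mul] at hs
  have h1 : F (Pi.single t 1) s ≠ 0 := fun e ↦ hs (by rw [e, zero_mul])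
  have h2 : F' (Pi.single s 1) u ≠ 0 := fun e ↦ hs (by rw [e, mul_zero])
  exact (hF t s h1).trans (hF' s u h2)

/-- Sums of filtered maps are filtered. [folklore] -/
theorem Filt.add [DecidableEq T] {F F' : (T → R) →ₗ[R] (S → R)}
    (hF : Filt dT dS F) (hF' : Filt dT dS F') : Filt dT dS (F + F') := by
  intro t s hne
  rw [LinearMap.add_apply, Pi.add_apply] at hne
  by_cases h1 : F (Pi.single t 1) s = 0
  · rw [h1, zero_add] at hne
    exact hF' t s hne
  · exact hF t s h1

/-- The zero map is filtered. [folklore] -/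
theorem Filt.zero [DecidableEq T] : Filt dT dS (0 : (T → R) →ₗ[R] (S → R)) :=
  fun _ _ hne ↦ (hne rfl).elim

/-- The identity is filtered. [folklore] -/
theorem Filt.id [DecidableEq T] : Filt dT dT (LinearMap.id : (T → R) →ₗ[R] (T → R)) := by
  intro t s hne
  rw [LinearMap.id_apply, Pi.single_apply] at hne
  by_cases h : s = t
  · rw [h]
  · exact (hne (if_neg h)).elim

/-- The matrix map of a filtered matrix is filtered. [folklore] -/
theorem Filt.mMap [Fintype T] [DecidableEq T] {M : T → S → R}
    (hM : ∀ t s, M t s ≠ 0 → dT t ≤ dS s) : Filt dT dS (mMap M) := by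
  intro t s hne
  rw [mMap_single] at hne
  exact hM t s hne

/-- The map `F` of `MHtpy.ofEquiv` is filtered when the bijection preserves degrees. [folklore] -/
theorem Filt.ofEquiv_F [Fintype S] [Fintype T] [DecidableEq T] (e : T ≃ S) (I : S → S → R)
    (J : T → T → R) (hIJ : ∀ a b, J a b = I (e a) (e b)) (hd : ∀ t, dS (e t) = dT t) :
    Filt dT dS (MHtpy.ofEquiv e I J hIJ).F := by
  intro t s hne
  rw [MHtpy.ofEquiv_F_apply, Pi.single_apply] at hne
  by_cases h : e.symm s = t
  · have hs : s = e t := by rw [← h, e.apply_symm_apply]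
    rw [hs, hd]
  · exact (hne (if_neg h)).elim

/-- See `Filt.ofEquiv_F`. [folklore] -/
theorem Filt.ofEquiv_B [Fintype S] [Fintype T] [DecidableEq S] (e : T ≃ S) (I : S → S → R)
    (J : T → T → R) (hIJ : ∀ a b, J a b = I (e a) (e b)) (hd : ∀ t, dS (e t) = dT t) :
    Filt dS dT (MHtpy.ofEquiv e I J hIJ).B := by
  intro s t hne
  rw [MHtpy.ofEquiv_B_apply, Pi.single_apply] at hne
  by_cases h : e t = s
  · rw [← h, hd]
  · exact (hne (if_neg h)).elim

/-- The map `F` of `MHtpy.rescale` is filtered. [folklore] -/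
theorem Filt.rescale_F [Fintype S] [DecidableEq S] (I : S → S → R) (u : S → R)
    (hu : ∀ s, u s * u s = 1) : Filt dS dS (MHtpy.rescale I u hu).F := by
  intro t s hne
  rw [MHtpy.rescale_F_apply, Pi.single_apply] at hne
  by_cases h : s = t
  · rw [h]
  · exact (hne (by rw [if_neg h, mul_zero])).elim

/-- See `Filt.rescale_F`. [folklore] -/
theorem Filt.rescale_B [Fintype S] [DecidableEq S] (I : S → S → R) (u : S → R)
    (hu : ∀ s, u s * u s = 1) : Filt dS dS (MHtpy.rescale I u hu).B := by
  intro t s hne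
  rw [MHtpy.rescale_B_apply, Pi.single_apply] at hne
  by_cases h : s = t
  · rw [h]
  · exact (hne (by rw [if_neg h, mul_zero])).elim

end Filt

/-! ## Gaussian elimination is filtered -/

section Elim

variable {X C : Type} [Fintype X] [Fintype C] [DecidableEq X] [DecidableEq C]
  {I : X ⊕ (X ⊕ C) → X ⊕ (X ⊕ C) → R} {dM : X ⊕ (X ⊕ C) → ℤ}
  (hI : ∀ a b, I a b ≠ 0 → dM a ≤ dM b) (hbe : ∀ x, dM (.inr (.inl x)) = dM (.inl x))

include hI hbe in
omit [Fintype X] [DecidableEq X] in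
/-- **The chain map `F` of Gaussian elimination is filtered** when the matrix is filtered and the
cancelled identity block joins vectors of equal degree (for the degree of `C` induced from `M`).
Bar-Natan (2007), Lemma 4.2; Rasmussen (2010), §6. [cite: BarNatan2007, Lemma 4.2] -/
theorem filt_elim_F : Filt (fun r ↦ dM (.inr (.inr r))) dM (mMap (R := R) (matF I)) := by
  refine Filt.mMap fun r s hne ↦ ?_
  rcases s with x | x | r'
  · rw [matF_inl, neg_ne_zero] at hne
    exact (hI _ _ hne).trans (hbe x).le
  · exact (hne rfl).elim
  · rw [matF_inr_inr] at hne
    by_cases h : r = r'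
    · rw [h]
    · exact (hne (if_neg h)).elim

include hI hbe in
/-- **The chain map `B` of Gaussian elimination is filtered.** [cite: BarNatan2007, Lemma 4.2] -/
theorem filt_elim_B : Filt dM (fun r ↦ dM (.inr (.inr r))) (mMap (R := R) (matB I)) := by
  refine Filt.mMap fun s r hne ↦ ?_
  rcases s with x | x | r'
  · exact (hne rfl).elim
  · rw [matB_inr_inl, neg_ne_zero] at hne
    rw [hbe]
    exact hI _ _ hne
  · rw [matB_inr_inr] at hne
    by_cases h : r' = r
    · rw [h]
    · exact (hne (if_neg h)).elim

end Elim

/-! ## Filtered homotopy data -/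

section IsFilt

variable {S T U : Type} [Fintype S] [Fintype T] [Fintype U]
  [DecidableEq S] [DecidableEq T] [DecidableEq U] {I : S → S → R} {J : T → T → R} {L : U → U → R}

/-- Homotopy data whose two chain maps are **filtered** for the degree maps `dS`, `dT`.
Rasmussen (2010), §6. [cite: Rasmussen2010, §6] -/
structure MHtpy.IsFilt (D : MHtpy I J) (dS : S → ℤ) (dT : T → ℤ) : Prop where
  /-- `F` is filtered. -/
  F : Filt dT dS D.F
  /-- `B` is filtered. -/
  B : Filt dS dT D.B

/-- Filtered homotopy data compose. [folklore] -/
theorem MHtpy.IsFilt.trans {D₁ : MHtpy I J} {D₂ : MHtpy J L} {dS : S → ℤ} {dT : T → ℤ}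
    {dU : U → ℤ} (h₁ : D₁.IsFilt dS dT) (h₂ : D₂.IsFilt dT dU) : (D₁.trans D₂).IsFilt dS dU where
  F := by
    show Filt dU dS (D₁.F ∘ₗ D₂.F)
    exact h₂.F.comp h₁.F
  B := by
    show Filt dS dU (D₂.B ∘ₗ D₁.B)
    exact h₁.B.comp h₂.B

/-- `ofEquiv` is filtered when the bijection preserves degrees. [folklore] -/
theorem MHtpy.IsFilt.ofEquiv (e : T ≃ S) (I : S → S → R) (J : T → T → R)
    (hIJ : ∀ a b, J a b = I (e a) (e b)) {dS : S → ℤ} {dT : T → ℤ}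
    (hd : ∀ t, dS (e t) = dT t) : (MHtpy.ofEquiv e I J hIJ).IsFilt dS dT where
  F := Filt.ofEquiv_F e I J hIJ hd
  B := Filt.ofEquiv_B e I J hIJ hd

/-- `rescale` is filtered. [folklore] -/
theorem MHtpy.IsFilt.rescale (I : S → S → R) (u : S → R) (hu : ∀ s, u s * u s = 1)
    (dS : S → ℤ) : (MHtpy.rescale I u hu).IsFilt dS dS where
  F := Filt.rescale_F I u hu
  B := Filt.rescale_B I u hu

/-- `congrRight` keeps the filtration property. [folklore] -/
theorem MHtpy.IsFilt.congrRight {D : MHtpy I J} {J' : T → T → R} (hJ : ∀ a b, J a b = J' a b)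
    {dS : S → ℤ} {dT : T → ℤ} (h : D.IsFilt dS dT) : (D.congrRight hJ).IsFilt dS dT :=
  ⟨h.F, h.B⟩

/-- `refl` is filtered. [folklore] -/
theorem MHtpy.IsFilt.refl (dS : S → ℤ) : (MHtpy.refl I).IsFilt dS dS :=
  ⟨Filt.id, Filt.id⟩

/-- **Gaussian elimination is filtered.** [cite: BarNatan2007, Lemma 4.2] -/
theorem MHtpy.IsFilt.elim {X C : Type} [Fintype X] [Fintype C] [DecidableEq X] [DecidableEq C]
    {I : X ⊕ (X ⊕ C) → X ⊕ (X ⊕ C) → R} (h2 : ∀ a z, ∑ y, I a y * I y z = 0)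
    (hφ : ∀ x x', I (.inl x) (.inr (.inl x')) = if x = x' then 1 else 0)
    {dM : X ⊕ (X ⊕ C) → ℤ} (hI : ∀ a b, I a b ≠ 0 → dM a ≤ dM b)
    (hbe : ∀ x, dM (.inr (.inl x)) = dM (.inl x)) :
    (KhElim.elim h2 hφ).IsFilt dM (fun r ↦ dM (.inr (.inr r))) where
  F := filt_elim_F hI hbe
  B := filt_elim_B hI hbe

end IsFilt

end KhElim

end Literature.Topology.FourManifolds
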